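import Literature.Analysis.TotalPositivity.MultiplyPositiveProofs
import Mathlib.LinearAlgebra.Matrix.ToLinearEquiv
import Mathlib.LinearAlgebra.Matrix.Nondegenerate
import Mathlib.LinearAlgebra.Matrix.Adjugate
import Mathlib.LinearAlgebra.Matrix.DotProduct
import Mathlib.Data.Real.Basic
import HarnessLib

/-!
# Matrix lemmas for the Matveev–Nesterenko sublattice lever (Nesterenko 2003, Prop. 2.6, (2.9)–(2.12))

Cell topic `Summits/ABC/StewartYu` (cell abc-stewartyu, seat p4); namespace
`Summit.ABC.StewartYu.MatveevLever` (theorems only). The determinant bookkeeping of the proof of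
Nesterenko 2003, Prop. 2.6 (LNM 1819, pp. 57–58) — the place-free geometry-of-numbers lever of the
Gen-3 (`cⁿ`-quality) engines of rung A1.M3 (route `PadicPrimesKummerThird`); the lever itself
(`exists_short_relation`, with Minkowski's second theorem) is in the sequel `MatveevLever.lean`.
PROVED here:

* `det_map_castRingHom` — `det` commutes with `ℤ → R`;
* `abs_det_le_prod_sum_abs_col` / `abs_det_le_prod_sum_abs` / `abs_det_mul_prod_le` — the `ℓ¹`
  Hadamard inequality `|det X| ≤ ∏ᵢ ∑ⱼ |Xᵢⱼ|` ("Hadamard's inequality" of loc. cit., in the form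
  used for (2.11)–(2.12): Leibniz expansion, the permutations being among all maps) and its scaled
  form `|det X| ∏ⱼ dⱼ ≤ ∏ᵢ ∑ⱼ |Xᵢⱼ| dⱼ`;
* `det_mul_transpose_self_ne_zero` — `ℤ`-independent rows have a non-zero Gram determinant;
* `exists_cols_det_ne_zero` — `ν` `ℤ`-independent rows of `ℤⁿ` have a non-singular `ν × ν`
  column minor ("let `Δ` be a nonzero minor of order `ν`"; Cauchy–Binet expansion of the Gram
  determinant, `Literature.Analysis.TotalPositivity.det_mul_eq_sum_pi`);
* `det_smul_eq_sum_cramer_smul` — the Cramer lift (2.9)–(2.10): if `d b = ∑ cᵢ zᵢ` (`d ≠ 0`) and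
  `Z_J` is a non-singular column minor of `(zᵢⱼ)`, then `det Z_J • b = ∑ᵢ Δᵢ • zᵢ` on ALL
  coordinates, `Δᵢ = det(Z_J with row i replaced by b_J)`; so `m₀ := Δ`, `mᵢ := Δᵢ` satisfy the
  printed relation, and the printed reduction to coprime `mᵢ` (which only serves `|m₀| ≤ |Δ|`,
  `|mᵢ| ≤ |Δᵢ|`) is not needed.

WHAT THIS IS NOT: no geometry of numbers yet (sequel file); no engine statement.

## References

* [Nesterenko2003] Yu. V. Nesterenko, *Linear forms in logarithms of rational numbers*, in:
  Diophantine Approximation (Cetraro 2000), LNM 1819, Springer 2003, 53–106: proof of Prop. 2.6,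
  (2.9)–(2.12), p. 58.
-/

noncomputable section

namespace Summit.ABC.StewartYu.MatveevLever

open Matrix Finset

/-! ### Casting integer determinants -/

/-- `det (Z mod cast) = cast (det Z)` for the ring map `ℤ → R`. [folklore] -/
theorem det_map_castRingHom {ν : ℕ} (R : Type*) [CommRing R] (N : Matrix (Fin ν) (Fin ν) ℤ) :
    (N.map (Int.castRingHom R)).det = (N.det : R) := by
  rw [← RingHom.mapMatrix_apply, ← RingHom.map_det, eq_intCast]

/-! ### The `ℓ¹` Hadamard inequality -/

/-- **`ℓ¹` Hadamard inequality, column form**: `|det X| ≤ ∏ⱼ ∑ᵢ |Xᵢⱼ|` (Leibniz expansion; the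
sum over permutations is part of the sum over all maps, all terms being non-negative).
[cite: Nesterenko2003, proof of Prop 2.6 ("Hadamard's inequality"), p. 58] -/
theorem abs_det_le_prod_sum_abs_col {ν : ℕ} (X : Matrix (Fin ν) (Fin ν) ℝ) :
    |X.det| ≤ ∏ j, ∑ i, |X i j| := by
  classical
  rw [Matrix.det_apply']
  calc |∑ σ : Equiv.Perm (Fin ν), ((Equiv.Perm.sign σ : ℤ) : ℝ) * ∏ i, X (σ i) i|
      ≤ ∑ σ : Equiv.Perm (Fin ν), |((Equiv.Perm.sign σ : ℤ) : ℝ) * ∏ i, X (σ i) i| :=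
        Finset.abs_sum_le_sum_abs _ _
    _ = ∑ σ : Equiv.Perm (Fin ν), ∏ i, |X (σ i) i| := by
        refine Finset.sum_congr rfl fun σ _ => ?_
        have hs : |((Equiv.Perm.sign σ : ℤ) : ℝ)| = 1 := by
          rcases Int.units_eq_one_or (Equiv.Perm.sign σ) with h | h <;> simp [h]
        rw [abs_mul, hs, one_mul, Finset.abs_prod]
    _ = ∑ p ∈ (univ : Finset (Equiv.Perm (Fin ν))).image
          (fun σ : Equiv.Perm (Fin ν) => (σ : Fin ν → Fin ν)), ∏ i, |X (p i) i| := by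
        rw [Finset.sum_image (fun σ _ τ _ h => Equiv.coe_fn_injective h)]
    _ ≤ ∑ p ∈ Fintype.piFinset (fun _ : Fin ν => (univ : Finset (Fin ν))), ∏ i, |X (p i) i| := by
        refine Finset.sum_le_sum_of_subset_of_nonneg (fun p _ => ?_) (fun p _ _ => ?_)
        · exact Fintype.mem_piFinset.mpr fun _ => Finset.mem_univ _
        · exact Finset.prod_nonneg fun i _ => abs_nonneg _
    _ = ∏ j, ∑ i, |X i j| := (Finset.prod_univ_sum (fun _ => univ) (fun j i => |X i j|)).symm

/-- **`ℓ¹` Hadamard inequality, row form**: `|det X| ≤ ∏ᵢ ∑ⱼ |Xᵢⱼ|`.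
[cite: Nesterenko2003, proof of Prop 2.6 ("Hadamard's inequality"), p. 58] -/
theorem abs_det_le_prod_sum_abs {ν : ℕ} (X : Matrix (Fin ν) (Fin ν) ℝ) :
    |X.det| ≤ ∏ i, ∑ j, |X i j| := by
  rw [← Matrix.det_transpose]
  simpa only [Matrix.transpose_apply] using abs_det_le_prod_sum_abs_col Xᵀ

/-- Scaled row form: `|det X| · ∏ⱼ dⱼ ≤ ∏ᵢ ∑ⱼ |Xᵢⱼ| dⱼ` for `dⱼ ≥ 0` (Hadamard for `X · diag d`).
[folklore] -/
theorem abs_det_mul_prod_le {ν : ℕ} (X : Matrix (Fin ν) (Fin ν) ℝ) (d : Fin ν → ℝ)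
    (hd : ∀ j, 0 ≤ d j) : |X.det| * ∏ j, d j ≤ ∏ i, ∑ j, |X i j| * d j := by
  have h := abs_det_le_prod_sum_abs (X * Matrix.diagonal d)
  rw [Matrix.det_mul, Matrix.det_diagonal, abs_mul,
    abs_of_nonneg (Finset.prod_nonneg fun j _ => hd j)] at h
  refine h.trans_eq (Finset.prod_congr rfl fun i _ => Finset.sum_congr rfl fun j _ => ?_)
  rw [Matrix.mul_diagonal, abs_mul, abs_of_nonneg (hd j)]

/-! ### Non-singular minors of independent integer rows -/

/-- **`ℤ`-independent rows have non-zero Gram determinant**: if the rows of `Z ∈ M_{ν×n}(ℤ)` are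
linearly independent then `det(Z Zᵀ) ≠ 0` (`Z Zᵀ v = 0 ⇒ |Zᵀ v|² = 0 ⇒ vZ = 0 ⇒ v = 0`).
[folklore] -/
theorem det_mul_transpose_self_ne_zero {ν n : ℕ} (Z : Matrix (Fin ν) (Fin n) ℤ)
    (hZ : LinearIndependent ℤ (fun i => Z i)) : (Z * Zᵀ).det ≠ 0 := by
  classical
  intro hdet
  obtain ⟨v, hv0, hv⟩ := Matrix.exists_mulVec_eq_zero_iff.mpr hdet
  have h1 : (v ᵥ* Z) ⬝ᵥ (v ᵥ* Z) = 0 := by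
    calc (v ᵥ* Z) ⬝ᵥ (v ᵥ* Z) = (v ᵥ* Z) ⬝ᵥ (Zᵀ *ᵥ v) := by rw [Matrix.mulVec_transpose]
      _ = v ⬝ᵥ (Z *ᵥ (Zᵀ *ᵥ v)) := (Matrix.dotProduct_mulVec v Z _).symm
      _ = 0 := by rw [Matrix.mulVec_mulVec, hv, dotProduct_zero]
  have h2 : v ᵥ* Z = 0 := dotProduct_self_eq_zero.mp h1
  rw [Matrix.vecMul_eq_sum] at h2
  exact hv0 (funext fun i => Fintype.linearIndependent_iff.mp hZ v h2 i)

/-- **A non-singular `ν × ν` column minor of `ν` independent integer rows.** If the rows of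
`Z ∈ M_{ν×n}(ℤ)` are `ℤ`-linearly independent, there is an injective `e : Fin ν → Fin n` with
`det (Z_{i, e k}) ≠ 0` (expand `det(Z Zᵀ) ≠ 0` as a sum over column selections).
[cite: Nesterenko2003, proof of Prop 2.6 ("let Δ be a nonzero minor of order ν"), p. 58] -/
theorem exists_cols_det_ne_zero {ν n : ℕ} (Z : Matrix (Fin ν) (Fin n) ℤ)
    (hZ : LinearIndependent ℤ (fun i => Z i)) :
    ∃ e : Fin ν → Fin n, Function.Injective e ∧ (Z.submatrix id e).det ≠ 0 := by
  classical
  have hG := det_mul_transpose_self_ne_zero Z hZ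
  rw [Literature.Analysis.TotalPositivity.det_mul_eq_sum_pi] at hG
  obtain ⟨e, -, he⟩ := Finset.exists_ne_zero_of_sum_ne_zero hG
  have hdet : (Z.submatrix id e).det ≠ 0 := right_ne_zero_of_mul he
  refine ⟨e, ?_, hdet⟩
  by_contra hinj
  obtain ⟨k, k', hkk', hne⟩ := Function.not_injective_iff.mp hinj
  exact hdet (Matrix.det_zero_of_column_eq hne (fun i => by simp [Matrix.submatrix_apply, hkk']))

/-! ### Cramer lift of an integer relation -/

/-- **Cramer lift.** Let `z₁, …, z_ν ∈ ℤⁿ`, `e` a selection of `ν` columns with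
`Δ = det(zᵢ(e k))_{i,k} ≠ 0`, and `b ∈ ℤⁿ` with `d b = ∑ cᵢ zᵢ` for some integer `d ≠ 0`
(`b` a rational combination of the `zᵢ`). Then `Δ • b = ∑ᵢ Δᵢ • zᵢ` on all `n` coordinates,
where `Δᵢ` is the Cramer numerator — the determinant of the minor with its `i`-th row replaced
by `(b(e k))_k` (`Matrix.cramer` of the transposed minor).
[cite: Nesterenko2003, proof of Prop 2.6, (2.9)–(2.10), p. 58] -/
theorem det_smul_eq_sum_cramer_smul {ν n : ℕ} (z : Fin ν → (Fin n → ℤ)) (e : Fin ν → Fin n)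
    (hdet : (Matrix.of fun i k => z i (e k)).det ≠ 0)
    (b : Fin n → ℤ) (d : ℤ) (hd : d ≠ 0) (c : Fin ν → ℤ) (hb : d • b = ∑ i, c i • z i) :
    (Matrix.of fun i k => z i (e k)).det • b =
      ∑ i, (Matrix.cramer (Matrix.of fun i k => z i (e k))ᵀ (fun k => b (e k)) i) • z i := by
  classical
  set N : Matrix (Fin ν) (Fin ν) ℤ := Matrix.of fun i k => z i (e k) with hN
  set m : Fin ν → ℤ := Matrix.cramer Nᵀ (fun k => b (e k)) with hm
  -- the relation, coordinatewise, in `ℚ`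
  have hbq : ∀ j, (d : ℚ) * (b j : ℚ) = ∑ i, (c i : ℚ) * (z i j : ℚ) := fun j => by
    have h := congrFun hb j
    simp only [Pi.smul_apply, smul_eq_mul, Finset.sum_apply] at h
    exact_mod_cast h
  -- integer Cramer identity on the selected columns: `∑ i, z i (e k) * m i = Δ * b (e k)`
  have hcr : ∀ k, ∑ i, z i (e k) * m i = N.det * b (e k) := fun k => by
    have h := congrFun (Matrix.mulVec_cramer Nᵀ (fun k => b (e k))) k
    rw [Matrix.det_transpose] at h
    simpa [Matrix.mulVec, dotProduct, Matrix.transpose_apply, hN, hm] using h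
  -- the transposed minor is injective over `ℚ`
  set Nq : Matrix (Fin ν) (Fin ν) ℚ := N.map (Int.castRingHom ℚ) with hNq
  have hNqTdet : Nqᵀ.det ≠ 0 := by
    rw [Matrix.det_transpose, hNq, det_map_castRingHom]; exact_mod_cast hdet
  have hmulVec : ∀ x : Fin ν → ℚ, ∀ k, (Nqᵀ *ᵥ x) k = ∑ i, (z i (e k) : ℚ) * x i := fun x k => by
    simp [Matrix.mulVec, dotProduct, hNq, hN, Matrix.transpose_apply, Matrix.map_apply]
  -- both `d m` and `Δ c` solve the same square system, hence agree
  have hmq : ∀ i, (d : ℚ) * (m i : ℚ) = (N.det : ℚ) * (c i : ℚ) := by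
    have h0 : Nqᵀ *ᵥ ((fun i => (d : ℚ) * (m i : ℚ)) - fun i => (N.det : ℚ) * (c i : ℚ)) = 0 := by
      rw [Matrix.mulVec_sub]
      funext k
      rw [Pi.sub_apply, hmulVec, hmulVec, Pi.zero_apply, sub_eq_zero]
      have h1 : ∑ i, (z i (e k) : ℚ) * ((d : ℚ) * (m i : ℚ)) =
          (d : ℚ) * ((N.det : ℚ) * (b (e k) : ℚ)) := by
        have h' : ∑ i, (z i (e k) : ℚ) * (m i : ℚ) = (N.det : ℚ) * (b (e k) : ℚ) := by
          exact_mod_cast hcr k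
        rw [← h', Finset.mul_sum]
        exact Finset.sum_congr rfl fun i _ => by ring
      have h2 : ∑ i, (z i (e k) : ℚ) * ((N.det : ℚ) * (c i : ℚ)) =
          (N.det : ℚ) * ((d : ℚ) * (b (e k) : ℚ)) := by
        rw [hbq (e k), Finset.mul_sum]
        exact Finset.sum_congr rfl fun i _ => by ring
      rw [h1, h2]; ring
    intro i
    have h := congrFun (Matrix.eq_zero_of_mulVec_eq_zero hNqTdet h0) i
    simpa [sub_eq_zero] using h
  -- conclude coordinatewise: `d (Δ bⱼ) = d ∑ mᵢ zᵢⱼ` in `ℚ`, then cancel `d`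
  have hdq : (d : ℚ) ≠ 0 := by exact_mod_cast hd
  funext j
  have hgoal : (d : ℚ) * ((N.det : ℚ) * (b j : ℚ)) = (d : ℚ) * ∑ i, (m i : ℚ) * (z i j : ℚ) := by
    rw [Finset.mul_sum]
    calc (d : ℚ) * ((N.det : ℚ) * (b j : ℚ)) = (N.det : ℚ) * ((d : ℚ) * (b j : ℚ)) := by ring
      _ = (N.det : ℚ) * ∑ i, (c i : ℚ) * (z i j : ℚ) := by rw [hbq j]
      _ = ∑ i, ((N.det : ℚ) * (c i : ℚ)) * (z i j : ℚ) := by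
          rw [Finset.mul_sum]; exact Finset.sum_congr rfl fun i _ => by ring
      _ = ∑ i, (d : ℚ) * ((m i : ℚ) * (z i j : ℚ)) :=
          Finset.sum_congr rfl fun i _ => by rw [← hmq i]; ring
  have hgoal' : ((N.det : ℚ) * (b j : ℚ)) = ∑ i, (m i : ℚ) * (z i j : ℚ) :=
    mul_left_cancel₀ hdq hgoal
  simp only [Pi.smul_apply, smul_eq_mul, Finset.sum_apply]
  exact_mod_cast hgoal'

end Summit.ABC.StewartYu.MatveevLever

end
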